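import Literature.Geometry.Riemannian.ShrinkerMinimumPrinciple
import HarnessLib

/-!
# Stub `stub_minimumPrinciple` (X_B) of line `collapsed-ends-usc` (crux
# `EntropyRung.NoncompactShrinkerGap`, stmt-SmoothPoincare4-10868): the localised minimum principle

Fact X of the line — "a complete connected gradient shrinking Ricci soliton `Ric + Hess f = g/2`
has `R ≥ 0`" (Z.-H. Zhang, PAMS 137 (2009), Thm. 1.3 (ii), proof Step 1; B.-L. Chen, JDG 82
(2009), Cor. 2.5) — is split by the skeleton (v6) into X_A, the weighted Laplacian comparison for
`d(p, ·)` along geodesic directions (an upper-barrier datum), and X_B: the datum forces `R ≥ 0`.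
X_B is PROVED in `Literature/Geometry/Riemannian/ShrinkerMinimumPrinciple.lean`
(`Zhang2009.minimumPrinciple_core`, any model space `E`; its one-variable calculus in
`ShrinkerMinimumPrincipleCalculus.lean`, first landed as this line's helper
`EntropyRungNoncompactShrinkerGapStubMinimumPrincipleCalculus.lean`). This file is the registered
stub verbatim: the corollary at `E = ℝⁿ` (`finrank_euclideanSpace_fin`), the `C¹` regularity
instance of the smooth Levi-Civita connection being supplied by
`isLocallyContMDiff_leviCivita_holds`. The normalisation `R + |∇f|² = f` is not used.
-/

noncomputable section

-- `Summit.SmoothPoincare4.SmoothPoincare4.…` (summit = problem) trips `dupNamespace` on every decl.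
set_option linter.dupNamespace false

open scoped Manifold ContDiff Topology NNReal ENNReal
open Set Filter Module
open Literature.Geometry.Lorentzian Literature.Geometry.Riemannian

namespace Summit.SmoothPoincare4.SmoothPoincare4.Theorems.NoncompactShrinkerGapMinimumPrinciple

/-- **Stub `stub_minimumPrinciple` (X_B) of line `collapsed-ends-usc`** — the localised minimum
principle (Zhang 2009, proof of Thm. 1.3, Step 1; B.-L. Chen 2009, Cor. 2.5) in the registered form
(= the skeleton's `MinimumPrincipleAtInfinity`, unfolded): on a complete connected gradient shrinker
`Ric + Hess f = g/2` the directional comparison datum (stub X_A) forces `R ≥ 0`. It is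
`Zhang2009.minimumPrinciple_core` at `E = ℝⁿ` (`finrank_euclideanSpace_fin`), the `C¹`
regularity instance of the smooth Levi-Civita connection being supplied by
`isLocallyContMDiff_leviCivita_holds`; the normalisation `R + |∇f|² = f` is not used. [folklore] -/
theorem stub_minimumPrinciple : ∀ (n : ℕ) (M : Type) [TopologicalSpace M] [T2Space M] [SecondCountableTopology M] [ChartedSpace (EuclideanSpace ℝ (Fin n)) M] [IsManifold (𝓡 n) ∞ M] [ConnectedSpace M] [T3Space M] [MeasurableSpace M] [BorelSpace M] (g : PseudoRiemannianMetric (𝓡 n) ∞ (EuclideanSpace ℝ (Fin n)) (TangentSpace (𝓡 n) : M → Type _)) [g.HasLeviCivita] (f : M → ℝ) (hg : g.IsRiemannian), (∀ (x : M) (r : NNReal), IsCompact {y : M | g.edist hg x y ≤ r}) → ContMDiff (𝓡 n) 𝓘(ℝ, ℝ) ∞ f → (∀ (x : M) (X Y : TangentSpace (𝓡 n) x), g.ricci x X Y + g.hessian f x X Y = (1 / 2 : ℝ) * g.val x X Y) → (∀ x : M, g.scalarCurvature x + g.gradSq f x = f x) → (∀ p : M, ∃ C : ℝ, ∀ x₀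 : M, 1 ≤ (g.edist hg p x₀).toReal → ∃ (k : ℕ) (e : Option (Fin k) → TangentSpace (𝓡 n) x₀) (q : Option (Fin k) → ℝ), Fintype.card (Option (Fin k)) = n ∧ (∀ o o', g.val x₀ (e o) (e o') = if o = o' then 1 else 0) ∧ 2 * (∑ o, q o) - mvfderiv (𝓡 n) f x₀ (e none) ≤ C ∧ ∀ o, ∀ᶠ s in 𝓝 (0 : ℝ), (g.edist hg p (expMap g.leviCivita x₀ (s • e o))).toReal ≤ (g.edist hg p x₀).toReal + (if o = none then s else 0) + q o * s ^ 2) → ∀ x : M, 0 ≤ g.scalarCurvature x := by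
  intro n M _ _ _ _ _ _ _ _ _ g _ f hg hcpt hf hsol _ hcmp x
  have hk1 : ((1 : ℕ∞) : ℕ∞ω) + 1 ≤ (∞ : ℕ∞ω) := by
    rw [show ((1 : ℕ∞) : ℕ∞ω) + 1 = 2 by norm_num]
    exact WithTop.coe_le_coe.2 le_top
  haveI : CovariantDerivative.ContMDiffCovariantDerivative g.leviCivita 1 :=
    ⟨g.isLocallyContMDiff_leviCivita_holds 1 hk1 univ isOpen_univ⟩
  refine Zhang2009.minimumPrinciple_core g hg hcpt hf hsol (fun p ↦ ?_) x
  obtain ⟨C, hC⟩ := hcmp p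
  refine ⟨C, fun x₀ hx₀ ↦ ?_⟩
  obtain ⟨k, e, q, hcard, hon, hCq, hbar⟩ := hC x₀ hx₀
  exact ⟨k, e, q, by rw [hcard, finrank_euclideanSpace_fin], hon, hCq, hbar⟩

end Summit.SmoothPoincare4.SmoothPoincare4.Theorems.NoncompactShrinkerGapMinimumPrinciple

end
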